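import Mathlib
import HarnessLib
import Summits.HubbardSuperconductivity.HubbardSuperconductivity.Theorems.KLProgrammeKLRegimeEngineE4ScaleDoor

/-!
# (E4)ₙ door, FIXED-LABEL form (CORRECTION of the residual's shape): the first moments from the weighted position sum AT FIXED SECTOR LABELS

Cell gate-hubbard-kl, seat hubbard-kl-k3c3-p2 (g6); companion / correction of `…EngineE4ScaleDoor` (p518391).  There the door
`engineFirstMoments_of_wtPinnedSum` asks the weighted pinned sum `klWtPinnedSum … n 4 0 (0, ℓ₀)` — leg `0` pinned, the other three legs summed over
positions AND SECTOR LABELS (the weighted determinant-bound output format) — to be `≤ klE0·(G.cE4 + Q.cE4|U|)·P.Klam·|U|`, an `n`-FREE budget.  That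
hypothesis is HONESTLY UNSATISFIABLE at large `n`: the label sums carry the sector count (`sectorCount n = 2^{n+1}`; the (E1-v4) all-label quartic norm
is `≤ CE²·ε_n·2ⁿ`), while (E4)'s allowance is `n`-free only PER FIXED LABEL TUPLE (the clause `EngineFirstMoments` fixes all four labels `Ω` and sums
positions only).  So the residual the (E4) producers owe is the FIXED-LABEL weighted position sum, stated here (no new definition):

* `klScale_mul_firstMoment_le_wtSum_fixed` — `Λ_n·ε_x³·Σ_x dist(x_i,x_k)‖W̄_Ω(0,x)‖ ≤ ε_x³·Σ_x klScaleWt_n(positions of (0,x))·‖W̄_Ω(0,x)‖` (every `n`, `Ω`, `i`, `k`);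
* **`engineFirstMoments_of_wtSum_fixed`** — `(∀ Ω, ε_x³·Σ_x klScaleWt_n(positions)·‖W̄_Ω(0,x)‖ ≤ klE0·((G.cE4 + Q.cE4|U|)·P.Klam·|U|)) → EngineFirstMoments … n`
  (ONE inequality PER LABEL 4-TUPLE, `n`-free right side in `Λ_n`-units — this is the satisfiable shape: BGM (2.52)-type fixed-sector decay);
* `wtSum_fixed_le_klWtPinnedSum` — the fixed-label sum is at most the all-label pinned sum (so p518391's door is the special case where the stronger
  all-label bound happens to hold, e.g. at scale `0`).
Consequence for the v5 thread: the all-label (E1-W) invariant `KernelNormsWt (klWtBudget …) … n` (whose honest budget at `m = 4` follows the E1 scale law)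
does NOT make (E4)ₙ bookkeeping; stub (c) keeps (E4)ₙ as a genuine fixed-label obligation.  Pure bookkeeping; nothing about the model is asserted.
-/

noncomputable section

namespace Summit.HubbardSuperconductivity.HubbardSuperconductivity.Theorems.EngineV8

set_option linter.dupNamespace false -- summit = problem name (single-conjunct summit), D-0017

open Real Finset Literature.MathematicalPhysics.QuantumLattice Literature.Probability.LatticeModels
open Literature.Probability.LatticeModels.BattleFederbush
open Literature.MathematicalPhysics.QuantumLattice.GrassmannAlgebra
open Summit.HubbardSuperconductivity.HubbardSuperconductivity.Theorems.KLRegimeSplit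
open Summit.HubbardSuperconductivity.HubbardSuperconductivity.Theorems.KLProgrammeLegKernels

variable {L M : ℕ} [NeZero L] [NeZero M]

/-- **First moments are dominated by the weighted position sum AT FIXED LABELS** (pure bookkeeping, every scale, `β ≥ 0`):
`Λ_n · ε_x³ · Σ_x dist(x_i, x_k)·‖W̄_Ω(0,x)‖ ≤ ε_x³ · Σ_x klScaleWt_n(positions of (0,x))·‖W̄_Ω(0,x)‖`. -/
theorem klScale_mul_firstMoment_le_wtSum_fixed {β : ℝ} (hβ : 0 ≤ β) (U μ : ℝ) (K : TrigPolyC4v) (n : ℕ)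
    (Ω : Fin 4 → SectorLeg (sectorCount n)) (i k : Fin 4) :
    klScale klE0 n * (imagTimeWeight β M ^ 3 *
        ∑ x : Fin 3 → SpaceTimeIdx L M,
          KLRegimeSplit.spaceTimeDist L M β (Matrix.vecCons (0 : SpaceTimeIdx L M) x i) (Matrix.vecCons (0 : SpaceTimeIdx L M) x k) *
            ‖klAnisoLegKernel L M β U μ K klE0 n 4 Ω (Matrix.vecCons (0 : SpaceTimeIdx L M) x)‖) ≤
      imagTimeWeight β M ^ 3 *
        ∑ x : Fin 3 → SpaceTimeIdx L M,
          klScaleWt L M β n ((univ.image (fun j : Fin 4 => (Matrix.vecCons (0 : SpaceTimeIdx L M) x j, Ω j))).image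
              (latticeLegPos (2 * (2 * M)))) *
            ‖klAnisoLegKernel L M β U μ K klE0 n 4 Ω (Matrix.vecCons (0 : SpaceTimeIdx L M) x)‖ := by
  have hε : 0 ≤ imagTimeWeight β M ^ 3 := pow_nonneg (imagTimeWeight_nonneg hβ M) 3
  rw [mul_left_comm]
  refine mul_le_mul_of_nonneg_left ?_ hε
  rw [mul_sum]
  refine sum_le_sum fun x _ => ?_
  rw [← mul_assoc]
  refine mul_le_mul_of_nonneg_right ?_ (norm_nonneg _)
  set X : Fin 4 → SpaceTimeIdx L M × SectorLeg (sectorCount n) := fun j => (Matrix.vecCons (0 : SpaceTimeIdx L M) x j, Ω j) with hX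
  have hd := klScale_mul_spaceTimeDist_le_klScaleWt_image_sub_one (L := L) (M := M) hβ n X i k
  have hXi : (X i).1 = Matrix.vecCons (0 : SpaceTimeIdx L M) x i := rfl
  have hXk : (X k).1 = Matrix.vecCons (0 : SpaceTimeIdx L M) x k := rfl
  rw [hXi, hXk] at hd
  linarith

/-- **THE (E4)ₙ DOOR, FIXED-LABEL FORM (the satisfiable shape).**  If at scale `n`, for EVERY label 4-tuple `Ω`, the weighted position sum of the
sectorised quartic kernel with leg `0` at the origin obeys `ε_x³·Σ_x klScaleWt_n(positions)·‖W̄_Ω(0,x)‖ ≤ klE0 · ((G.cE4 + Q.cE4|U|)·P.Klam·|U|)`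
(`n`-free in `Λ_n`-units, per label tuple), then `EngineFirstMoments L M G P Q β U μ K n` (`β > 0`). -/
theorem engineFirstMoments_of_wtSum_fixed {β : ℝ} (hβ : 0 < β) {U μ : ℝ} {K : TrigPolyC4v} {n : ℕ}
    {G : GeoConsts} {P : SplitConsts} {Q : EngConsts}
    (h : ∀ Ω : Fin 4 → SectorLeg (sectorCount n),
      imagTimeWeight β M ^ 3 *
          ∑ x : Fin 3 → SpaceTimeIdx L M,
            klScaleWt L M β n ((univ.image (fun j : Fin 4 => (Matrix.vecCons (0 : SpaceTimeIdx L M) x j, Ω j))).image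
                (latticeLegPos (2 * (2 * M)))) *
              ‖klAnisoLegKernel L M β U μ K klE0 n 4 Ω (Matrix.vecCons (0 : SpaceTimeIdx L M) x)‖ ≤
        klE0 * ((G.cE4 + Q.cE4 * |U|) * P.Klam * |U|)) :
    EngineFirstMoments L M G P Q β U μ K n := by
  intro Ω i k
  have hΛ := klth_klScale_pos n
  have hmain := (klScale_mul_firstMoment_le_wtSum_fixed (L := L) (M := M) hβ.le U μ K n Ω i k).trans (h Ω)
  have e := klScale_klE0_mul_four_pow n
  set B : ℝ := (G.cE4 + Q.cE4 * |U|) * P.Klam * |U| with hB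
  have h2 : klE0 * B / klScale klE0 n = B * (4 : ℝ) ^ n := by
    rw [show klE0 * B / klScale klE0 n = klScale klE0 n * (4 : ℝ) ^ n * B / klScale klE0 n by rw [e]]
    field_simp
  calc _ = klScale klE0 n * (imagTimeWeight β M ^ 3 *
          ∑ x : Fin 3 → SpaceTimeIdx L M,
            KLRegimeSplit.spaceTimeDist L M β (Matrix.vecCons (0 : SpaceTimeIdx L M) x i) (Matrix.vecCons (0 : SpaceTimeIdx L M) x k) *
              ‖klAnisoLegKernel L M β U μ K klE0 n 4 Ω (Matrix.vecCons (0 : SpaceTimeIdx L M) x)‖) / klScale klE0 n :=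
        (mul_div_cancel_left₀ _ hΛ.ne').symm
    _ ≤ klE0 * B / klScale klE0 n := div_le_div_of_nonneg_right hmain hΛ.le
    _ = B * (4 : ℝ) ^ n := h2

/-- **The fixed-label sum is at most the all-label pinned sum** (`β ≥ 0`): so the all-label door of `…EngineE4ScaleDoor` is the special case in which
the stronger all-label bound holds. -/
theorem wtSum_fixed_le_klWtPinnedSum {β : ℝ} (hβ : 0 ≤ β) (U μ : ℝ) (K : TrigPolyC4v) (n : ℕ) (Ω : Fin 4 → SectorLeg (sectorCount n)) :
    imagTimeWeight β M ^ 3 *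
        ∑ x : Fin 3 → SpaceTimeIdx L M,
          klScaleWt L M β n ((univ.image (fun j : Fin 4 => (Matrix.vecCons (0 : SpaceTimeIdx L M) x j, Ω j))).image
              (latticeLegPos (2 * (2 * M)))) *
            ‖klAnisoLegKernel L M β U μ K klE0 n 4 Ω (Matrix.vecCons (0 : SpaceTimeIdx L M) x)‖ ≤
      klWtPinnedSum L M β U μ K n 4 0 ((0 : SpaceTimeIdx L M), Ω 0) := by
  set E := sectorAnalysisMatrix L M β (klAnisoFamily L M β μ K klE0 n) with hE
  set W := klEffectiveAction L M β U μ K klE0 n with hW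
  set Φ : (Fin 3 → SpaceTimeIdx L M) → (Fin 4 → SpaceTimeIdx L M × SectorLeg (sectorCount n)) :=
    fun x j => (Matrix.vecCons (0 : SpaceTimeIdx L M) x j, Ω j) with hΦ
  have hΦinj : Function.Injective Φ := by
    intro x x' h
    funext j
    have hj := congrFun h j.succ
    rw [hΦ] at hj
    simpa using (Prod.ext_iff.1 hj).1
  have hΦmem : ∀ x, Φ x ∈ univ.filter (fun X : Fin 4 → SpaceTimeIdx L M × SectorLeg (sectorCount n) =>
      X 0 = ((0 : SpaceTimeIdx L M), Ω 0)) := fun x => by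
    refine mem_filter.2 ⟨mem_univ _, ?_⟩
    rw [hΦ]
    rfl
  have hker : ∀ x, klAnisoLegKernel L M β U μ K klE0 n 4 Ω (Matrix.vecCons (0 : SpaceTimeIdx L M) x) =
      kernel ℂ (ExteriorAlgebra.map (Matrix.toLin' E) W) 4 (Φ x) := fun x => klAnisoLegKernel_eq_kernel_map β U μ K klE0 n 4 Ω _
  have hwt0 : ∀ S, 0 ≤ klScaleWt L M β n S := fun S => zero_le_one.trans (one_le_klScaleWt L M β n S)
  rw [klWtPinnedSum_def, show (4 - 1 : ℕ) = 3 from rfl]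
  refine mul_le_mul_of_nonneg_left ?_ (pow_nonneg (imagTimeWeight_nonneg hβ M) 3)
  calc ∑ x : Fin 3 → SpaceTimeIdx L M, klScaleWt L M β n ((univ.image (Φ x)).image (latticeLegPos (2 * (2 * M)))) *
          ‖klAnisoLegKernel L M β U μ K klE0 n 4 Ω (Matrix.vecCons (0 : SpaceTimeIdx L M) x)‖
      = ∑ x : Fin 3 → SpaceTimeIdx L M, klScaleWt L M β n ((univ.image (Φ x)).image (latticeLegPos (2 * (2 * M)))) *
          ‖kernel ℂ (ExteriorAlgebra.map (Matrix.toLin' E) W) 4 (Φ x)‖ := sum_congr rfl fun x _ => by rw [hker x]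
    _ = ∑ X ∈ (univ : Finset (Fin 3 → SpaceTimeIdx L M)).image Φ, klScaleWt L M β n ((univ.image X).image (latticeLegPos (2 * (2 * M)))) *
          ‖kernel ℂ (ExteriorAlgebra.map (Matrix.toLin' E) W) 4 X‖ := by
        rw [sum_image fun x _ x' _ h => hΦinj h]
    _ ≤ ∑ X ∈ univ.filter (fun X : Fin 4 → SpaceTimeIdx L M × SectorLeg (sectorCount n) => X 0 = ((0 : SpaceTimeIdx L M), Ω 0)),
          klScaleWt L M β n ((univ.image X).image (latticeLegPos (2 * (2 * M)))) * ‖kernel ℂ (ExteriorAlgebra.map (Matrix.toLin' E) W) 4 X‖ := by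
        refine sum_le_sum_of_subset_of_nonneg (fun X hX => ?_) fun X _ _ => mul_nonneg (hwt0 _) (norm_nonneg _)
        obtain ⟨x, -, rfl⟩ := mem_image.1 hX
        exact hΦmem x

end Summit.HubbardSuperconductivity.HubbardSuperconductivity.Theorems.EngineV8

end
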